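import Mathlib
import HarnessLib
import Literature.Computability.AlgebraicComplexity.BorderRankCW
import Literature.Computability.AlgebraicComplexity.AsymptoticSubrankDuality
import Literature.Computability.AlgebraicComplexity.PrattTripartitionBoundsProofs
import Summits.MatrixMultiplication.MatrixMultiplication.Theses.OutsiderSandwich
import Summits.MatrixMultiplication.MatrixMultiplication.Theorems.OutsiderSandwichSlopeDialCore
import Summits.MatrixMultiplication.MatrixMultiplication.Theorems.OutsiderSandwichExchangeSpectral
import Summits.MatrixMultiplication.MatrixMultiplication.Theorems.OutsiderSandwichBlockOneRank

/-!
# OutsiderSandwich — the CORNER-SLOPE DIAL at the two corners of the route (decomp-mm lens 4, gen 31, part 2/2)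

Route `route-MatrixMultiplication-OutsiderSandwich`; cut of record UNCHANGED
(`closes (h₁ : LaserTangency) (h₂ : LaserMergeOptimal) (h₃ : SummitIffLaserTangency)`).  Part 1
(`OutsiderSandwichSlopeDialCore`) defined `SlopeFloor t a μ` (`∀ F, a + μ(τ_F − 2) ≤ log₂F(t)`, ω-free)
and `SlopeCap t a μ` (`∃ F, τ_F = ω ∧ log₂F(t) ≤ a + μ(ω − 2)`, ω-relative) and proved that EVERY pair
`μ' < μ` is an exact cut `ω = 2 ⟺ SlopeFloor ∧ SlopeCap`, the floor strengthening to the summit and the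
cap weakening to a triviality as the slopes grow.  This file reads the route's items off the dial.

§2 THE `cw₂` CORNER `(2, log₂ 3)` (`x_F = log₂ F(cw₂) ∈ [log₂3, 2]`: `three_le_map_cwTensor`, `xExp_le_two`):
* `cwFloor_third`         — slope `1/3` IS the laser floor (`LaserFloor` 33322, proved): the dial starts at a theorem;
* `cwCap_third_iff`       — **cap `1/3 ⟺ LaserMergeOptimal`** (27897): the residual of record is the
  `μ' = 1/3` member of the cap family, and `cwCap_of_laserMergeOptimal` — every cap `μ' ≥ 1/3` is WEAKER;
* `summit_iff_cwDial`     — **`ω = 2 ⟺ SlopeFloor cw₂ (log₂3) μ ∧ SlopeCap cw₂ (log₂3) μ'` for every `μ' < μ`**;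
* `laserTangency_of_cwFloor` — every slope `μ > 1/3` gives `LaserTangency` (32268) (`LaserFloorStrict`
  with linear modulus `(μ − 1/3)η`); `exists_cwFloor_of_perfectBeyondLaser` — `PerfectBeyondLaser`
  (31793) gives some slope `> 1/3` (the LNT floor); `cwFloor_of_cwTwoMMPerfect` — **TOP (27896) gives
  slope `log₂3/2`** (`F(cw₂) ≥ 3^{τ_F/2}`);
* `cwFloor_one_iff`       — slope `1 ⟺ ∀ F, 3·F⟨2,2,2⟩ ≤ 4·F(cw₂)` (Strassen: `⟨3⟩ ⊠ ⟨2,2,2⟩ ≲ ⟨4⟩ ⊠ cw₂`,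
  «four little CW tensors buy three `2×2` matrix products»);
* `omega_le_of_cwFloor`   — cash value `ω ≤ 2 + (2 − log₂3)/μ`: slope `1` pays only `ω ≤ 4 − log₂3 ≈ 2.415`
  (below no record — a genuinely intermediate, ω-free statement), slope `μ` beats `2.3713` only for
  `μ > 1.117`, and `summit_iff_forall_cwFloor`: `ω = 2 ⟺` all slopes;
* `exists_cwCap`          — the cap family reaches TRUE unconditionally (`μ' ≥ (2 − log₂3)/(ω − 2)` if `ω > 2`);
* `packing_volume_le_of_cwCap` — the caps' intrinsic reading: cap `μ'` ⟹ every packing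
  `⟨B⟩ ⊗ ⟨m,m,m⟩ ≤ cw₂^{⊠N}` has ω-volume `B m^ω ≤ (3·2^{μ'(ω−2)})^N` (at `μ' = 1/3` the laser-class law).
So the node of record is the pair `(slope via TOP ≈ log₂3/2, cap 1/3)`; dialing to `(μ, μ')` with
`1/3 < μ' < μ` trades a STRICTLY WEAKER residual (a top point may sit `(μ'−1/3)(ω−2)` above the floor —
separating picture: «laser merging not optimal, but by less than that») for a STRICTLY STRONGER ω-free
floor, continuously, down to residual TRUE at `μ = ∞` (= the summit itself).

§3 THE BLOCK CORNER `(2, 2)` of `C₁ = coupling₁` (`4 ≤ F(C₁) ≤ 7`): `blockFloor_one_iff` — **slope `1 ⟺`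
the aside leaf `BlockOneIsMM`** (27147); `blockCap_one_iff` — cap `1 ⟺ BlockOneMergeOptimal` (27149);
`summit_iff_blockDial` — `ω = 2 ⟺ SlopeFloor C₁ 2 σ ∧ SlopeCap C₁ 2 σ'` (`σ' < σ`), in particular
`summit_of_blockOneIsMM_of_cap`: the leaf plus ANY cap of slope `< 1` decides the summit;
`omega_le_of_blockFloor` — the leaf alone pays only `2^ω ≤ 7`.

No new items, no route edit (OPS hold).  `SlopeFloor`/`SlopeCap` are predicate families, not conjectures.
References: Strassen, Crelle 384 (1988) Thm. 2.3–2.4, 3.8 [Strassen1988]; Strassen, Crelle 413 (1991) §6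
[Strassen1991]; Coppersmith–Winograd, JSC 9 (1990) §6–7 [CoppersmithWinograd1990]; Christandl–Vrana–Zuiddam,
J. AMS 36 (2023) Prop. 1.6, Cor. 3.31 [ChristandlVranaZuiddam2023]; Conner–Huang–Landsberg, arXiv:2009.11391
§1 (`R(cw₂) ≤ 4` over `ℂ`) [ConnerHuangLandsberg2020]; Bürgisser–Clausen–Shokrollahi (1997) Thm. 15.41
[BurgisserClausenShokrollahi1997]; Wigderson–Zuiddam, *Asymptotic spectra* (2023) §5 [WigdersonZuiddam2023];
Alman–Li–Pratt, arXiv:2604.01386 (2026) §8.1 (support-function reading `ω(a,b,c) = max_{γ∈Δ_MM} aγ₁+bγ₂+cγ₃`,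
after Strassen 1988 Prop. 4.5 — the floors here are support-function bounds of the shadow `(τ_F, log₂F t)`).
-/

set_option linter.dupNamespace false

namespace Summit.MatrixMultiplication.MatrixMultiplication.Theorems.OutsiderSandwichSlopeDial

open Literature.Computability.AlgebraicComplexity
open Summit.MatrixMultiplication.MatrixMultiplication.Theses.OutsiderSandwich
open Summit.MatrixMultiplication.MatrixMultiplication.Theorems.OutsiderSandwichLaserFloor
  (two_le_matExp one_le_map_matMulTensor laserFloor)
open Summit.MatrixMultiplication.MatrixMultiplication.Theorems.OutsiderSandwichLaserFloorCut
  (matExp_le_omega three_le_map_cwTensor)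
open Summit.MatrixMultiplication.MatrixMultiplication.Theorems.OutsiderSandwichLaserFloorTop
  (exists_top_point)
open Summit.MatrixMultiplication.MatrixMultiplication.Theorems.OutsiderSandwichTouchingPoints
  (laserMergeOptimal_iff_corner)
open Summit.MatrixMultiplication.MatrixMultiplication.Theorems.OutsiderSandwichSpectralConverse
  (laserTangency_of_strict)
open Summit.MatrixMultiplication.MatrixMultiplication.Theorems.OutsiderSandwichCornerAngle
  (lntFloor matExp_eq_two_of_summit)
open Summit.MatrixMultiplication.MatrixMultiplication.Theorems.OutsiderSandwichContactFace
  (gaugePoint₁_cwTensor_two gaugePoint₁_matMulTensor_two)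
open Summit.MatrixMultiplication.MatrixMultiplication.Theorems.OutsiderSandwichSlopeDialCore

variable {F : SpectralMap ℂ}

/-! ## §2  The `cw₂` corner `(2, log₂ 3)`: laser floor, TOP, the residual of record, LaserTangency -/

section CwTwo

/-- `log₂ F(cw₂) ≤ 2` for every universal spectral point: `F(cw₂) ≤ R̃(cw₂) ≤ R(cw₂) ≤ 4` over `ℂ`
(the rank-4 expression `8·cw₂ = (1,2,0)^{⊗3} − (1,0,2i)^{⊗3} − (1,0,−2i)^{⊗3} + (1,−2,0)^{⊗3}`, a
local copy of the landed decomposition as in `OutsiderSandwichBlockOneWorldsFaithful`).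
[cite: ConnerHuangLandsberg2020, §1; Strassen1988, Thm. 3.8] -/
theorem xExp_le_two (hF : IsUniversalSpectralPoint ℂ F) : Real.logb 2 (F (cwTensor ℂ 2)) ≤ 2 := by
  have hR : tensorRank (cwTensor ℂ 2) ≤ 4 := by
    refine tensorRank_le_of_eq_sum
      (fun e a => (![1 / 8, -1 / 8, -1 / 8, 1 / 8] : Fin 4 → ℂ) e *
        (![![1, 2, 0], ![1, 0, 2 * Complex.I], ![1, 0, -2 * Complex.I], ![1, -2, 0]] :
          Fin 4 → Fin 3 → ℂ) e a)
      (![![1, 2, 0], ![1, 0, 2 * Complex.I], ![1, 0, -2 * Complex.I], ![1, -2, 0]] :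
        Fin 4 → Fin 3 → ℂ)
      (![![1, 2, 0], ![1, 0, 2 * Complex.I], ![1, 0, -2 * Complex.I], ![1, -2, 0]] :
        Fin 4 → Fin 3 → ℂ) ?_
    funext a b c
    simp only [Finset.sum_apply, Fin.sum_univ_four, triad, cwTensor_apply]
    fin_cases a <;> fin_cases b <;> fin_cases c <;> simp <;>
      first
        | ring1
        | linear_combination Complex.I_sq
  have h4 : F (cwTensor ℂ 2) ≤ 4 :=
    ((strassen_duality_asymptoticRank_holds ℂ (cwTensor ℂ 2)).1 F hF).trans
      ((asymptoticRank_le_tensorRank (cwTensor ℂ 2)).trans (by exact_mod_cast hR))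
  have h0 : 0 < F (cwTensor ℂ 2) := lt_of_lt_of_le (by norm_num) (three_le_map_cwTensor hF)
  calc Real.logb 2 (F (cwTensor ℂ 2)) ≤ Real.logb 2 4 := Real.logb_le_logb_of_le one_lt_two h0 h4
    _ = 2 := by
      rw [show (4 : ℝ) = 2 ^ (2 : ℕ) by norm_num, Real.logb_pow, Real.logb_self_eq_one one_lt_two]
      norm_num

/-- `log₂ F(cw₂) ≤ 2`, universally quantified form. [cite: ConnerHuangLandsberg2020, §1] -/
theorem xExp_le_two_all : ∀ F : SpectralMap ℂ, IsUniversalSpectralPoint ℂ F →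
    Real.logb 2 (F (cwTensor ℂ 2)) ≤ 2 := fun _ hF => xExp_le_two hF

/-- **Slope `1/3` = the laser floor** (route item `LaserFloor`, proved): the dial's bottom end is a
THEOREM. [cite: CoppersmithWinograd1990, §6; Strassen1988, Thm. 3.8] -/
theorem cwFloor_third : SlopeFloor (cwTensor ℂ 2) (Real.logb 2 3) (1 / 3) := by
  intro G hG
  have h := laserFloor hG
  linarith

/-- Slope `0`: `log₂ 3 ≤ log₂ F(cw₂)` (`F(cw₂) ≥ Q̃(cw₂) = 3`). [cite: Strassen1988, Thm. 3.8] -/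
theorem cwFloor_zero : SlopeFloor (cwTensor ℂ 2) (Real.logb 2 3) 0 :=
  slopeFloor_anti (by norm_num) cwFloor_third

/-- The gauge corner: Strassen's support functional `ζ₁` is a universal point with
`log₂ ζ₁(cw₂) = log₂ 3` (and `ζ₁⟨2,2,2⟩ = 4`). [cite: Strassen1988, Thm. 3.8] -/
theorem exists_gauge_corner : ∃ F : SpectralMap ℂ, IsUniversalSpectralPoint ℂ F ∧
    Real.logb 2 (F (cwTensor ℂ 2)) ≤ Real.logb 2 3 :=
  ⟨gaugePoint₁ ℂ, gaugePoint₁_isUniversalSpectralPoint ℂ, by rw [gaugePoint₁_cwTensor_two]⟩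

/-- **THE `cw₂` DIAL IS EXACT AT EVERY PAIR OF SLOPES `μ' < μ`:**
`ω(ℂ) = 2 ⟺ SlopeFloor cw₂ (log₂3) μ ∧ SlopeCap cw₂ (log₂3) μ'`. [cite: Strassen1988, Thm. 2.3–2.4] -/
theorem summit_iff_cwDial {s s' : ℝ} (hlt : s' < s) :
    _root_.MatrixMultiplication ↔
      SlopeFloor (cwTensor ℂ 2) (Real.logb 2 3) s ∧ SlopeCap (cwTensor ℂ 2) (Real.logb 2 3) s' :=
  summit_iff_floor_and_cap hlt cwFloor_zero exists_gauge_corner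

/-- **The residual of record is the cap at slope `1/3`:** `SlopeCap cw₂ (log₂3) (1/3) ⟺ LaserMergeOptimal`
(a top point on or under the floor line is ON it, by the laser floor; and `laserMergeOptimal_iff_corner`).
[cite: CoppersmithWinograd1990, §6; Strassen1988, Thm. 2.3–2.4] -/
theorem cwCap_third_iff : SlopeCap (cwTensor ℂ 2) (Real.logb 2 3) (1 / 3) ↔ LaserMergeOptimal := by
  rw [laserMergeOptimal_iff_corner]
  constructor
  · rintro ⟨G, hG, hGω, hGcap⟩
    have hfl := laserFloor hG
    rw [hGω] at hfl
    exact ⟨G, hG, hGω, le_antisymm (by linarith) (by linarith)⟩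
  · rintro ⟨G, hG, hGω, hGx⟩
    exact ⟨G, hG, hGω, by rw [hGx]; linarith⟩

/-- Hence `LaserMergeOptimal` gives the cap at every slope `μ ≥ 1/3`: the dialed residuals are WEAKER
than the residual of record. [cite: CoppersmithWinograd1990, §6] -/
theorem cwCap_of_laserMergeOptimal {s : ℝ} (hs : 1 / 3 ≤ s) (h : LaserMergeOptimal) :
    SlopeCap (cwTensor ℂ 2) (Real.logb 2 3) s :=
  slopeCap_mono hs (cwCap_third_iff.2 h)

/-- **Packing reading of the caps** (the intrinsic, ω-relative law behind `SlopeCap cw₂ (log₂3) μ'`):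
every packing `⟨B⟩ ⊗ ⟨m,m,m⟩ ≤ cw₂^{⊠N}` has ω-VOLUME `B · m^ω ≤ (3 · 2^{μ'(ω − 2)})^N` — at `μ' = 1/3`
the laser-class capacity law `B m^ω ≤ 3^N 2^{(ω−2)N/3}` for ALL packings (= laser merging optimal), at
larger `μ'` a weaker exchange rate (apply the capped top point to the packing). [cite: CoppersmithWinograd1990, §6;
Strassen1988, Thm. 3.8] -/
theorem packing_volume_le_of_cwCap {s : ℝ} (hcap : SlopeCap (cwTensor ℂ 2) (Real.logb 2 3) s)
    {N B m : ℕ} (hm : 1 ≤ m)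
    (hres : TensorRestrictsTo (kroneckerPow (cwTensor ℂ 2) N)
      (kroneckerTensor (unitTensor ℂ B) (matMulTensor ℂ m m m))) :
    (B : ℝ) * (m : ℝ) ^ omega ℂ ≤ (3 * (2 : ℝ) ^ (s * (omega ℂ - 2))) ^ N := by
  obtain ⟨G, hG, hGω, hGcap⟩ := hcap
  have h1 := OutsiderSandwichLaserFloor.mul_rpow_le_pow_of_packing hG hm hres
  rw [hGω] at h1
  have hG0 : 0 < G (cwTensor ℂ 2) := lt_of_lt_of_le (by norm_num) (three_le_map_cwTensor hG)
  have h2 : G (cwTensor ℂ 2) ≤ 3 * (2 : ℝ) ^ (s * (omega ℂ - 2)) := by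
    have e : G (cwTensor ℂ 2) = (2 : ℝ) ^ Real.logb 2 (G (cwTensor ℂ 2)) :=
      (Real.rpow_logb two_pos (by norm_num) hG0).symm
    have e3 : (3 : ℝ) * (2 : ℝ) ^ (s * (omega ℂ - 2)) =
        (2 : ℝ) ^ (Real.logb 2 3 + s * (omega ℂ - 2)) := by
      rw [Real.rpow_add two_pos, Real.rpow_logb two_pos (by norm_num) (by norm_num)]
    rw [e, e3]
    exact Real.rpow_le_rpow_of_exponent_le one_le_two hGcap
  exact h1.trans (pow_le_pow_left₀ hG0.le h2 N)

/-- **Any slope `μ > 1/3` gives `LaserTangency`** (the attacked crux of the cut of record): the floor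
at slope `μ` is `LaserFloorStrict` with the linear modulus `δ(η) = (μ − 1/3) η`, and
`laserTangency_of_strict`. [cite: Strassen1988, Thm. 2.3; CoppersmithWinograd1990, §7] -/
theorem laserTangency_of_cwFloor {s : ℝ} (hs : 1 / 3 < s)
    (hfl : SlopeFloor (cwTensor ℂ 2) (Real.logb 2 3) s) : LaserTangency := by
  refine laserTangency_of_strict fun η hη => ⟨(s - 1 / 3) * η, mul_pos (sub_pos.2 hs) hη, ?_⟩
  intro G hG hτ
  have h1 := hfl G hG
  nlinarith [h1, mul_le_mul_of_nonneg_left hτ (sub_pos.2 hs).le]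

/-- **`PerfectBeyondLaser` puts the dial strictly above `1/3`** (the LNT floor of
`OutsiderSandwichCornerAngle.lntFloor`): some slope `μ > 1/3` holds. [cite: CoppersmithWinograd1990, §7] -/
theorem exists_cwFloor_of_perfectBeyondLaser (h : PerfectBeyondLaser) :
    ∃ s : ℝ, 1 / 3 < s ∧ SlopeFloor (cwTensor ℂ 2) (Real.logb 2 3) s := by
  obtain ⟨γ, hγ, hP⟩ := h
  exact ⟨1 / 3 + γ, by linarith, fun G hG => lntFloor hP hG⟩

/-- **TOP is the slope `log₂3 / 2`:** `CwTwoMMPerfect ⟹ SlopeFloor cw₂ (log₂3) (log₂3/2)`, i.e.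
`F(cw₂) ≥ 3^{τ_F/2}` for every universal point (apply `F` to `⟨m,m,m⟩ ≤ cw₂^{⊠N}`, `m² ≥ 3^{(1−ε)N}`:
`3^{(1−ε)τ_F/2} ≤ F(cw₂)`, then `ε → 0`). [cite: CoppersmithWinograd1990, §6; Strassen1988, Thm. 3.8] -/
theorem cwFloor_of_cwTwoMMPerfect (h : CwTwoMMPerfect) :
    SlopeFloor (cwTensor ℂ 2) (Real.logb 2 3) (Real.logb 2 3 / 2) := by
  intro G hG
  set τ := Real.logb 2 (G (matMulTensor ℂ 2 2 2)) with hτ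
  set x := Real.logb 2 (G (cwTensor ℂ 2)) with hx
  have hτ2 : 2 ≤ τ := two_le_matExp hG
  have hG3 : 3 ≤ G (cwTensor ℂ 2) := three_le_map_cwTensor hG
  have hG0 : 0 < G (cwTensor ℂ 2) := by linarith
  have hl3 : 0 < Real.logb 2 3 := Real.logb_pos one_lt_two (by norm_num)
  -- for every ε ∈ (0,1): (1 − ε) (τ/2) log₂3 ≤ x
  have key : ∀ ε : ℝ, 0 < ε → ε < 1 → (1 - ε) * (τ / 2 * Real.logb 2 3) ≤ x := by
    intro ε hε hε1
    obtain ⟨N, hN, m, hres, hm⟩ := h ε hε 1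
    have hm0 : (0 : ℝ) < m := by
      have h3 : (0 : ℝ) < (3 : ℝ) ^ ((1 - ε) * N) := Real.rpow_pos_of_pos (by norm_num) _
      have : (0 : ℝ) < (m : ℝ) ^ 2 := lt_of_lt_of_le h3 hm
      rcases Nat.eq_zero_or_pos m with h0 | h0
      · exfalso; rw [h0] at this; simp at this
      · exact_mod_cast h0
    have hm1 : 1 ≤ m := by exact_mod_cast hm0
    -- `m^τ ≤ G⟨m,m,m⟩ ≤ G(cw₂)^N`
    have h1 : (m : ℝ) ^ τ ≤ G (cwTensor ℂ 2) ^ N := by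
      have hmono := hG.mono _ _ hres
      rw [hG.map_kroneckerPow] at hmono
      exact (OutsiderSandwichLaserFloor.rpow_matExp_le_map_matMulTensor hG hm1).trans hmono
    -- logs: τ log₂ m ≤ N x and (1−ε) N log₂3 ≤ 2 log₂ m
    have h2 : τ * Real.logb 2 m ≤ N * x := by
      have := Real.logb_le_logb_of_le one_lt_two (Real.rpow_pos_of_pos hm0 τ) h1
      rwa [Real.logb_rpow_eq_mul_logb_of_pos hm0, Real.logb_pow] at this
    have h3 : (1 - ε) * N * Real.logb 2 3 ≤ 2 * Real.logb 2 m := by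
      have := Real.logb_le_logb_of_le one_lt_two (Real.rpow_pos_of_pos (by norm_num) _) hm
      rw [Real.logb_rpow_eq_mul_logb_of_pos (by norm_num : (0:ℝ) < 3), Real.logb_pow] at this
      push_cast at this; linarith
    have hN1 : (1 : ℝ) ≤ N := by exact_mod_cast hN
    have hlm : 0 ≤ Real.logb 2 m := Real.logb_nonneg one_lt_two (by exact_mod_cast hm1)
    -- combine: (1−ε) τ/2 log₂3 · N ≤ τ log₂ m ≤ N x
    have h4 : (1 - ε) * (τ / 2 * Real.logb 2 3) * N ≤ N * x := by
      have h5 : τ * ((1 - ε) * N * Real.logb 2 3) ≤ τ * (2 * Real.logb 2 m) :=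
        mul_le_mul_of_nonneg_left h3 (by linarith)
      nlinarith [h5, h2]
    have hN0 : (0 : ℝ) < N := by linarith
    exact le_of_mul_le_mul_right (by nlinarith [h4]) hN0
  -- ε → 0
  have hlim : τ / 2 * Real.logb 2 3 ≤ x := by
    refine le_of_forall_sub_le fun δ hδ => ?_
    have hc : 0 < τ / 2 * Real.logb 2 3 := by positivity
    set ε := min (1 / 2) (δ / (τ / 2 * Real.logb 2 3)) with hε
    have hε0 : 0 < ε := lt_min (by norm_num) (div_pos hδ hc)
    have hε1 : ε < 1 := lt_of_le_of_lt (min_le_left _ _) (by norm_num)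
    have hk := key ε hε0 hε1
    have hεδ : ε * (τ / 2 * Real.logb 2 3) ≤ δ := by
      have := min_le_right (1 / 2 : ℝ) (δ / (τ / 2 * Real.logb 2 3))
      rw [← hε] at this
      calc ε * (τ / 2 * Real.logb 2 3) ≤ δ / (τ / 2 * Real.logb 2 3) * (τ / 2 * Real.logb 2 3) :=
            mul_le_mul_of_nonneg_right this hc.le
        _ = δ := div_mul_cancel₀ δ hc.ne'
    nlinarith [hk, hεδ]
  -- `log₂3 + (log₂3/2)(τ − 2) = (τ/2) log₂3`
  have e : Real.logb 2 3 + Real.logb 2 3 / 2 * (τ - 2) = τ / 2 * Real.logb 2 3 := by ring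
  rw [e]; exact hlim

/-- **Slope `1` reads «four `cw₂` buy three `⟨2,2,2⟩`»:** `SlopeFloor cw₂ (log₂3) 1 ⟺ 3·F⟨2,2,2⟩ ≤ 4·F(cw₂)`
for every universal `F` (by Strassen's spectral theorem: `⟨3⟩ ⊠ ⟨2,2,2⟩ ≲ ⟨4⟩ ⊠ cw₂`).
[cite: Strassen1988, Thm. 3.8] -/
theorem cwFloor_one_iff : SlopeFloor (cwTensor ℂ 2) (Real.logb 2 3) 1 ↔
    ∀ F : SpectralMap ℂ, IsUniversalSpectralPoint ℂ F →
      3 * F (matMulTensor ℂ 2 2 2) ≤ 4 * F (cwTensor ℂ 2) := by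
  have key : ∀ G : SpectralMap ℂ, IsUniversalSpectralPoint ℂ G →
      (Real.logb 2 3 + 1 * (Real.logb 2 (G (matMulTensor ℂ 2 2 2)) - 2) ≤ Real.logb 2 (G (cwTensor ℂ 2)) ↔
        3 * G (matMulTensor ℂ 2 2 2) ≤ 4 * G (cwTensor ℂ 2)) := by
    intro G hG
    have hM0 : 0 < G (matMulTensor ℂ 2 2 2) :=
      lt_of_lt_of_le one_pos (one_le_map_matMulTensor hG (by norm_num))
    have hC0 : 0 < G (cwTensor ℂ 2) := lt_of_lt_of_le (by norm_num) (three_le_map_cwTensor hG)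
    have e1 : Real.logb 2 3 + 1 * (Real.logb 2 (G (matMulTensor ℂ 2 2 2)) - 2) =
        Real.logb 2 (3 * G (matMulTensor ℂ 2 2 2) / 4) := by
      rw [Real.logb_div (by positivity) (by norm_num), Real.logb_mul (by norm_num) hM0.ne',
        show (4 : ℝ) = 2 ^ (2 : ℕ) by norm_num, Real.logb_pow, Real.logb_self_eq_one one_lt_two]
      ring
    rw [e1, Real.logb_le_logb one_lt_two (by positivity) hC0, div_le_iff₀ (by norm_num : (0:ℝ) < 4)]
    constructor <;> intro h <;> linarith
  exact ⟨fun h G hG => (key G hG).1 (h G hG), fun h G hG => (key G hG).2 (h G hG)⟩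

/-- **Cash value on the `cw₂` dial:** slope `μ > 0` gives `ω ≤ 2 + (2 − log₂3)/μ`; e.g. slope `1` gives
only `ω ≤ 4 − log₂ 3 < 2.42` (below no record), slope `μ → ∞` gives `ω → 2`. [cite: Strassen1988, Thm. 2.4] -/
theorem omega_le_of_cwFloor {s : ℝ} (hs : 0 < s) (hfl : SlopeFloor (cwTensor ℂ 2) (Real.logb 2 3) s) :
    omega ℂ ≤ 2 + (2 - Real.logb 2 3) / s :=
  omega_le_of_slopeFloor hs hfl xExp_le_two_all

/-- **The summit is the top of the `cw₂` dial:** `ω = 2 ⟺ ∀ μ, SlopeFloor cw₂ (log₂3) μ`.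
[cite: Strassen1988, Thm. 2.3–2.4] -/
theorem summit_iff_forall_cwFloor :
    _root_.MatrixMultiplication ↔ ∀ s : ℝ, SlopeFloor (cwTensor ℂ 2) (Real.logb 2 3) s :=
  summit_iff_forall_slopeFloor xExp_le_two_all cwFloor_zero

/-- **The dialed residual vanishes:** unconditionally `∃ μ, SlopeCap cw₂ (log₂3) μ` (at `μ = 0` if
`ω = 2`, at `μ = (x_top − log₂3)/(ω − 2) ≤ (2 − log₂3)/(ω − 2)` if not). [cite: Strassen1988, Thm. 2.3–2.4] -/
theorem exists_cwCap : ∃ s : ℝ, SlopeCap (cwTensor ℂ 2) (Real.logb 2 3) s :=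
  exists_slopeCap exists_gauge_corner

end CwTwo

/-! ## §3  The block corner `(2, 2)`: the aside leaf `BlockOneIsMM` is the slope-`1` floor of `C₁` -/

section BlockOne

open Summit.MatrixMultiplication.MatrixMultiplication.Theorems.OutsiderSandwichCoupling (coupling₁)
open Summit.MatrixMultiplication.MatrixMultiplication.Theorems.OutsiderSandwichExchangeSpectral
  (four_le_map_coupling₁)

/-- `4 ≤ F(C₁)` (route item `BlockSubrankFull`, proved; tree `four_le_map_coupling₁`) as the slope-`0`
floor at the corner `(2,2)`. [cite: Strassen1991, §6] -/
theorem blockFloor_zero : SlopeFloor coupling₁ 2 0 := by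
  intro G hG
  have h4 : (4 : ℝ) ≤ G coupling₁ := four_le_map_coupling₁ hG
  have : Real.logb 2 4 ≤ Real.logb 2 (G coupling₁) :=
    Real.logb_le_logb_of_le one_lt_two (by norm_num) h4
  rw [show (4 : ℝ) = 2 ^ (2 : ℕ) by norm_num, Real.logb_pow, Real.logb_self_eq_one one_lt_two] at this
  simpa using this

/-- **The leaf is the slope-`1` floor of `C₁`:** `SlopeFloor C₁ 2 1 ⟺ BlockOneIsMM` (`F⟨2,2,2⟩ ≤ F(C₁)`).
[cite: Strassen1988, Thm. 3.8] -/
theorem blockFloor_one_iff : SlopeFloor coupling₁ 2 1 ↔ BlockOneIsMM := by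
  have key : ∀ G : SpectralMap ℂ, IsUniversalSpectralPoint ℂ G →
      (2 + 1 * (Real.logb 2 (G (matMulTensor ℂ 2 2 2)) - 2) ≤ Real.logb 2 (G coupling₁) ↔
        G (matMulTensor ℂ 2 2 2) ≤ G coupling₁) := by
    intro G hG
    have hM0 : 0 < G (matMulTensor ℂ 2 2 2) :=
      lt_of_lt_of_le one_pos (one_le_map_matMulTensor hG (by norm_num))
    have hC0 : 0 < G coupling₁ := lt_of_lt_of_le (by norm_num : (0 : ℝ) < 4) (four_le_map_coupling₁ hG)
    rw [show 2 + 1 * (Real.logb 2 (G (matMulTensor ℂ 2 2 2)) - 2) =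
      Real.logb 2 (G (matMulTensor ℂ 2 2 2)) by ring, Real.logb_le_logb one_lt_two hM0 hC0]
  exact ⟨fun h G hG => (key G hG).1 (h G hG), fun h G hG => (key G hG).2 (h G hG)⟩

/-- **`BlockOneMergeOptimal` is the slope-`1` cap of `C₁`:** `SlopeCap C₁ 2 1 ⟺ BlockOneMergeOptimal`.
[cite: Strassen1988, Thm. 2.3–2.4] -/
theorem blockCap_one_iff : SlopeCap coupling₁ 2 1 ↔ BlockOneMergeOptimal := by
  have key : ∀ G : SpectralMap ℂ, IsUniversalSpectralPoint ℂ G →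
      Real.logb 2 (G (matMulTensor ℂ 2 2 2)) = omega ℂ →
      (Real.logb 2 (G coupling₁) ≤ 2 + 1 * (omega ℂ - 2) ↔ G coupling₁ ≤ G (matMulTensor ℂ 2 2 2)) := by
    intro G hG hGω
    have hM0 : 0 < G (matMulTensor ℂ 2 2 2) :=
      lt_of_lt_of_le one_pos (one_le_map_matMulTensor hG (by norm_num))
    have hC0 : 0 < G coupling₁ := lt_of_lt_of_le (by norm_num : (0 : ℝ) < 4) (four_le_map_coupling₁ hG)
    rw [show 2 + 1 * (omega ℂ - 2) = omega ℂ by ring, ← hGω, Real.logb_le_logb one_lt_two hC0 hM0]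
  constructor
  · rintro ⟨G, hG, hGω, hGcap⟩
    exact ⟨G, hG, hGω, (key G hG hGω).1 hGcap⟩
  · rintro ⟨G, hG, hGω, hGle⟩
    exact ⟨G, hG, hGω, (key G hG hGω).2 hGle⟩

/-- A universal point with `F(C₁) = 4 = Q̃(C₁)` (subrank duality, attained), i.e. `log₂F(C₁) ≤ 2`.
[cite: ChristandlVranaZuiddam2023, Prop. 1.6; Strassen1991, §6] -/
theorem exists_block_corner : ∃ F : SpectralMap ℂ, IsUniversalSpectralPoint ℂ F ∧
    Real.logb 2 (F coupling₁) ≤ 2 := by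
  obtain ⟨G, hG, hGeq⟩ := (strassen_duality_asymptoticSubrank_holds ℂ coupling₁).2
  refine ⟨G, hG, ?_⟩
  rw [hGeq, OutsiderSandwichBlockRank.asymptoticSubrank_coupling₁,
    show (4 : ℝ) = 2 ^ (2 : ℕ) by norm_num, Real.logb_pow, Real.logb_self_eq_one one_lt_two]
  norm_num

/-- **The block dial is exact too:** for every `σ' < σ`, `ω = 2 ⟺ SlopeFloor C₁ 2 σ ∧ SlopeCap C₁ 2 σ'`;
at `σ = 1` the floor is the leaf `BlockOneIsMM`, and as `σ → ∞` it is the summit. [cite: Strassen1988, Thm. 2.3–2.4] -/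
theorem summit_iff_blockDial {s s' : ℝ} (hlt : s' < s) :
    _root_.MatrixMultiplication ↔ SlopeFloor coupling₁ 2 s ∧ SlopeCap coupling₁ 2 s' :=
  summit_iff_floor_and_cap hlt blockFloor_zero exists_block_corner

/-- In particular the leaf with any cap of slope `< 1` decides the summit:
`BlockOneIsMM → SlopeCap C₁ 2 σ' → ω = 2` for `σ' < 1`. [cite: Strassen1988, Thm. 2.3–2.4] -/
theorem summit_of_blockOneIsMM_of_cap {s' : ℝ} (hlt : s' < 1) (h : BlockOneIsMM)
    (hcap : SlopeCap coupling₁ 2 s') : _root_.MatrixMultiplication :=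
  summit_of_floor_of_cap hlt (blockFloor_one_iff.2 h) hcap

/-- Cash value on the block dial (`log₂F(C₁) ≤ log₂ 7`, `R̃(C₁) ≤ 7`): slope `σ > 0` gives
`ω ≤ 2 + (log₂7 − 2)/σ` — at the leaf `σ = 1` only `2^ω ≤ 7`. [cite: Strassen1988, Thm. 2.4] -/
theorem omega_le_of_blockFloor {s : ℝ} (hs : 0 < s) (hfl : SlopeFloor coupling₁ 2 s) :
    omega ℂ ≤ 2 + (Real.logb 2 7 - 2) / s := by
  refine omega_le_of_slopeFloor hs hfl fun G hG => ?_
  have hC0 : 0 < G coupling₁ := lt_of_lt_of_le (by norm_num : (0 : ℝ) < 4) (four_le_map_coupling₁ hG)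
  exact Real.logb_le_logb_of_le one_lt_two hC0
    (((strassen_duality_asymptoticRank_holds ℂ coupling₁).1 G hG).trans
      OutsiderSandwichBlockOneRank.asymptoticRank_coupling₁_le_seven)

end BlockOne

end Summit.MatrixMultiplication.MatrixMultiplication.Theorems.OutsiderSandwichSlopeDial
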